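import Mathlib
import HarnessLib
import Summits.HubbardSuperconductivity.HubbardSuperconductivity.Theorems.KLProgrammeC4aJacobianPolarJets

/-!
# Route `KLProgramme` — crux C4a, named input (i) «Jacobian jets», ORDER 3 of the polar Jacobian `J = u / ∂_t e` (abstract polar setting)

Cell `gate-hubbard-kl`, lane hubbard-kl-c4a-1 (g2); helper for stub (C) of `KLRegimeEngineV17F2` (stmt-HubbardSuperconductivity-20437; memo
HOME/hubbard-kl-c4a-1/C4A-PLAN.md §12.2).  Continues `…C4aJacobianPolarJets` (orders 0–2) by one order, same setting (`e` a `C⁴` function on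
`Fin 2 → ℝ`, `u` a `C⁴` radius, `D ϑ = De(u ϑ•dir ϑ)[dir ϑ]`, sizes `E₁…E₄`, `U₀`, `R₁…R₃`, transversality `ρ₀`); GRADED (top order affine in `E₄`).
§0 op-norm bookkeeping `abs_clm₁…₄_le`; §1 `hasDerivAt_radialSlope_deriv_two` (`D‴` by one more `clm_apply` layer on the tree's polar tower),
`abs_radialSlope_deriv_three_le` (`|D‴| ≤ Δ₃ := E₄K₁³ + 3E₃K₁K₂ + 3E₃K₁² + E₂K₃ + 3E₂K₂ + 3E₂K₁ + E₁`, `K₁ = R₁+U₀`, `K₂ = R₂+2R₁+U₀`,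
`K₃ = R₃+3R₂+3R₁+U₀`); §2 `abs_deriv_three_polarJac_le`.  Pure calculus; nothing about the Hubbard model.
References: BGM 2006 §2.4 Lemma 2.1 (2.40) [cite: BenfattoGiulianiMastropietro2006].
-/

noncomputable section

namespace Summit.HubbardSuperconductivity.HubbardSuperconductivity.Theorems.C4a

set_option linter.dupNamespace false -- summit = problem name (single-conjunct summit), D-0017
set_option maxSynthPendingDepth 4 -- nested operator-norm instances (fourth Fréchet derivatives)

open Real Set
open Literature.MathematicalPhysics.QuantumLattice Literature.MathematicalPhysics.QuantumLattice.BandSectorCounting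
open Summit.HubbardSuperconductivity.HubbardSuperconductivity.Theorems.PerturbedFermiCurve

/-! ## §0 Operator-norm bookkeeping on `Fin 2 → ℝ` -/

/-- `|A w| ≤ ‖A‖·‖w‖`-type bound with majorants. -/
theorem abs_clm₁_le (A : (Fin 2 → ℝ) →L[ℝ] ℝ) (w : Fin 2 → ℝ) {EA nw : ℝ} (hA : ‖A‖ ≤ EA) (hw : ‖w‖ ≤ nw) :
    |A w| ≤ EA * nw := by
  rw [← Real.norm_eq_abs]
  exact (A.le_opNorm w).trans (mul_le_mul hA hw (norm_nonneg w) ((norm_nonneg A).trans hA))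

/-- Bilinear version. -/
theorem abs_clm₂_le (A : (Fin 2 → ℝ) →L[ℝ] (Fin 2 → ℝ) →L[ℝ] ℝ) (v w : Fin 2 → ℝ) {EA nv nw : ℝ} (hA : ‖A‖ ≤ EA)
    (hv : ‖v‖ ≤ nv) (hw : ‖w‖ ≤ nw) : |A v w| ≤ EA * nv * nw :=
  abs_clm₁_le (A v) w ((A.le_opNorm v).trans (mul_le_mul hA hv (norm_nonneg v) ((norm_nonneg A).trans hA))) hw

/-- Trilinear version. -/
theorem abs_clm₃_le (A : (Fin 2 → ℝ) →L[ℝ] (Fin 2 → ℝ) →L[ℝ] (Fin 2 → ℝ) →L[ℝ] ℝ) (v w x : Fin 2 → ℝ) {EA nv nw nx : ℝ}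
    (hA : ‖A‖ ≤ EA) (hv : ‖v‖ ≤ nv) (hw : ‖w‖ ≤ nw) (hx : ‖x‖ ≤ nx) : |A v w x| ≤ EA * nv * nw * nx :=
  abs_clm₂_le (A v) w x ((A.le_opNorm v).trans (mul_le_mul hA hv (norm_nonneg v) ((norm_nonneg A).trans hA))) hw hx

/-- Quadrilinear version. -/
theorem abs_clm₄_le (A : (Fin 2 → ℝ) →L[ℝ] (Fin 2 → ℝ) →L[ℝ] (Fin 2 → ℝ) →L[ℝ] (Fin 2 → ℝ) →L[ℝ] ℝ) (v w x y : Fin 2 → ℝ)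
    {EA nv nw nx ny : ℝ} (hA : ‖A‖ ≤ EA) (hv : ‖v‖ ≤ nv) (hw : ‖w‖ ≤ nw) (hx : ‖x‖ ≤ nx) (hy : ‖y‖ ≤ ny) :
    |A v w x y| ≤ EA * nv * nw * nx * ny :=
  abs_clm₃_le (A v) w x y ((A.le_opNorm v).trans (mul_le_mul hA hv (norm_nonneg v) ((norm_nonneg A).trans hA))) hw hx hy

section Polar

variable {e : (Fin 2 → ℝ) → ℝ} (he : ContDiff ℝ 4 e) {u : ℝ → ℝ} (hu : ContDiff ℝ 4 u)
include he hu

/-! ## §1 `D‴` -/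

/-- **`D‴`** as the derivative of the `D″`-expression of `hasDerivAt_radialSlope_deriv`. -/
theorem hasDerivAt_radialSlope_deriv_two (ϑ : ℝ) :
    HasDerivAt (fun t : ℝ =>
        (fderiv ℝ (fderiv ℝ (fderiv ℝ e)) (u t • dir t) (deriv u t • dir t + u t • dir (t + π / 2))
              (deriv u t • dir t + u t • dir (t + π / 2)) +
            fderiv ℝ (fderiv ℝ e) (u t • dir t) ((deriv (deriv u) t - u t) • dir t + (2 * deriv u t) • dir (t + π / 2))) (dir t) +
          fderiv ℝ (fderiv ℝ e) (u t • dir t) (deriv u t • dir t + u t • dir (t + π / 2)) (dir (t + π / 2)) +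
          (fderiv ℝ (fderiv ℝ e) (u t • dir t) (deriv u t • dir t + u t • dir (t + π / 2)) (dir (t + π / 2)) +
            fderiv ℝ e (u t • dir t) (-dir t)))
      (((((fderiv ℝ (fderiv ℝ (fderiv ℝ (fderiv ℝ e))) (u ϑ • dir ϑ) (deriv u ϑ • dir ϑ + u ϑ • dir (ϑ + π / 2))
                    (deriv u ϑ • dir ϑ + u ϑ • dir (ϑ + π / 2)) +
                  fderiv ℝ (fderiv ℝ (fderiv ℝ e)) (u ϑ • dir ϑ)
                    ((deriv (deriv u) ϑ - u ϑ) • dir ϑ + (2 * deriv u ϑ) • dir (ϑ + π / 2)))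
                  (deriv u ϑ • dir ϑ + u ϑ • dir (ϑ + π / 2)) +
                fderiv ℝ (fderiv ℝ (fderiv ℝ e)) (u ϑ • dir ϑ) (deriv u ϑ • dir ϑ + u ϑ • dir (ϑ + π / 2))
                  ((deriv (deriv u) ϑ - u ϑ) • dir ϑ + (2 * deriv u ϑ) • dir (ϑ + π / 2))) +
              (fderiv ℝ (fderiv ℝ (fderiv ℝ e)) (u ϑ • dir ϑ) (deriv u ϑ • dir ϑ + u ϑ • dir (ϑ + π / 2))
                  ((deriv (deriv u) ϑ - u ϑ) • dir ϑ + (2 * deriv u ϑ) • dir (ϑ + π / 2)) +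
                fderiv ℝ (fderiv ℝ e) (u ϑ • dir ϑ)
                  ((deriv (deriv (deriv u)) ϑ - 3 * deriv u ϑ) • dir ϑ + (3 * deriv (deriv u) ϑ - u ϑ) • dir (ϑ + π / 2))))
              (dir ϑ) +
            (fderiv ℝ (fderiv ℝ (fderiv ℝ e)) (u ϑ • dir ϑ) (deriv u ϑ • dir ϑ + u ϑ • dir (ϑ + π / 2))
                (deriv u ϑ • dir ϑ + u ϑ • dir (ϑ + π / 2)) +
              fderiv ℝ (fderiv ℝ e) (u ϑ • dir ϑ) ((deriv (deriv u) ϑ - u ϑ) • dir ϑ + (2 * deriv u ϑ) • dir (ϑ + π / 2)))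
              (dir (ϑ + π / 2))) +
          ((fderiv ℝ (fderiv ℝ (fderiv ℝ e)) (u ϑ • dir ϑ) (deriv u ϑ • dir ϑ + u ϑ • dir (ϑ + π / 2))
                (deriv u ϑ • dir ϑ + u ϑ • dir (ϑ + π / 2)) +
              fderiv ℝ (fderiv ℝ e) (u ϑ • dir ϑ) ((deriv (deriv u) ϑ - u ϑ) • dir ϑ + (2 * deriv u ϑ) • dir (ϑ + π / 2)))
              (dir (ϑ + π / 2)) +
            fderiv ℝ (fderiv ℝ e) (u ϑ • dir ϑ) (deriv u ϑ • dir ϑ + u ϑ • dir (ϑ + π / 2)) (-dir ϑ)) +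
        (((fderiv ℝ (fderiv ℝ (fderiv ℝ e)) (u ϑ • dir ϑ) (deriv u ϑ • dir ϑ + u ϑ • dir (ϑ + π / 2))
                  (deriv u ϑ • dir ϑ + u ϑ • dir (ϑ + π / 2)) +
                fderiv ℝ (fderiv ℝ e) (u ϑ • dir ϑ) ((deriv (deriv u) ϑ - u ϑ) • dir ϑ + (2 * deriv u ϑ) • dir (ϑ + π / 2)))
                (dir (ϑ + π / 2)) +
              fderiv ℝ (fderiv ℝ e) (u ϑ • dir ϑ) (deriv u ϑ • dir ϑ + u ϑ • dir (ϑ + π / 2)) (-dir ϑ)) +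
          (fderiv ℝ (fderiv ℝ e) (u ϑ • dir ϑ) (deriv u ϑ • dir ϑ + u ϑ • dir (ϑ + π / 2)) (-dir ϑ) +
            fderiv ℝ e (u ϑ • dir ϑ) (-dir (ϑ + π / 2))))) ϑ := by
  have h1 : ContDiff ℝ 3 (fderiv ℝ e) := he.fderiv_right (by norm_num)
  have h2 : ContDiff ℝ 2 (fderiv ℝ (fderiv ℝ e)) := h1.fderiv_right (by norm_num)
  have h3 : ContDiff ℝ 1 (fderiv ℝ (fderiv ℝ (fderiv ℝ e))) := h2.fderiv_right (by norm_num)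
  have hc1 : HasDerivAt (fun t : ℝ => fderiv ℝ e (u t • dir t))
      (fderiv ℝ (fderiv ℝ e) (u ϑ • dir ϑ) (deriv u ϑ • dir ϑ + u ϑ • dir (ϑ + π / 2))) ϑ :=
    ((h1.differentiable (by norm_num)) _).hasFDerivAt.comp_hasDerivAt ϑ (hasDerivAt_polar_zero hu ϑ)
  have hc2 : HasDerivAt (fun t : ℝ => fderiv ℝ (fderiv ℝ e) (u t • dir t))
      (fderiv ℝ (fderiv ℝ (fderiv ℝ e)) (u ϑ • dir ϑ) (deriv u ϑ • dir ϑ + u ϑ • dir (ϑ + π / 2))) ϑ :=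
    ((h2.differentiable (by norm_num)) _).hasFDerivAt.comp_hasDerivAt ϑ (hasDerivAt_polar_zero hu ϑ)
  have hc3 : HasDerivAt (fun t : ℝ => fderiv ℝ (fderiv ℝ (fderiv ℝ e)) (u t • dir t))
      (fderiv ℝ (fderiv ℝ (fderiv ℝ (fderiv ℝ e))) (u ϑ • dir ϑ) (deriv u ϑ • dir ϑ + u ϑ • dir (ϑ + π / 2))) ϑ :=
    ((h3.differentiable (by norm_num)) _).hasFDerivAt.comp_hasDerivAt ϑ (hasDerivAt_polar_zero hu ϑ)
  have hv1 := hasDerivAt_polar_one hu ϑ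
  have hv2 := hasDerivAt_polar_two hu ϑ
  have hd := PerturbedFermiCurve.hasDerivAt_dir ϑ
  have hdp := hasDerivAt_dir_add_pi_div_two ϑ
  have hdn : HasDerivAt (fun t : ℝ => -dir t) (-dir (ϑ + π / 2)) ϑ := hd.neg
  -- the CLM-valued inner sum `c₃ t (v₁ t) (v₁ t) + c₂ t (v₂ t)`
  have hS := ((hc3.clm_apply hv1).clm_apply hv1).add (hc2.clm_apply hv2)
  have hTab := hS.clm_apply hd
  have hTc := (hc2.clm_apply hv1).clm_apply hdp
  have hTe := hc1.clm_apply hdn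
  exact (hTab.add hTc).add (hTc.add hTe)


omit he hu in
/-- **`|D‴| ≤ Δ₃ = E₄K₁³ + 3E₃K₁K₂ + 3E₃K₁² + E₂K₃ + 3E₂K₂ + 3E₂K₁ + E₁`** (`K₁ = R₁+U₀`, `K₂ = R₂+2R₁+U₀`, `K₃ = R₃+3R₂+3R₁+U₀`). -/
theorem abs_radialSlope_deriv_three_le {ϑ E₁ E₂ E₃ E₄ U₀ R₁ R₂ R₃ : ℝ} (hE₁ : ‖fderiv ℝ e (u ϑ • dir ϑ)‖ ≤ E₁)
    (hE₂ : ‖fderiv ℝ (fderiv ℝ e) (u ϑ • dir ϑ)‖ ≤ E₂) (hE₃ : ‖fderiv ℝ (fderiv ℝ (fderiv ℝ e)) (u ϑ • dir ϑ)‖ ≤ E₃)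
    (hE₄ : ‖fderiv ℝ (fderiv ℝ (fderiv ℝ (fderiv ℝ e))) (u ϑ • dir ϑ)‖ ≤ E₄)
    (hU₀ : |u ϑ| ≤ U₀) (hR₁ : |deriv u ϑ| ≤ R₁) (hR₂ : |deriv (deriv u) ϑ| ≤ R₂) (hR₃ : |deriv (deriv (deriv u)) ϑ| ≤ R₃) :
    |((((fderiv ℝ (fderiv ℝ (fderiv ℝ (fderiv ℝ e))) (u ϑ • dir ϑ) (deriv u ϑ • dir ϑ + u ϑ • dir (ϑ + π / 2))
                    (deriv u ϑ • dir ϑ + u ϑ • dir (ϑ + π / 2)) +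
                  fderiv ℝ (fderiv ℝ (fderiv ℝ e)) (u ϑ • dir ϑ)
                    ((deriv (deriv u) ϑ - u ϑ) • dir ϑ + (2 * deriv u ϑ) • dir (ϑ + π / 2)))
                  (deriv u ϑ • dir ϑ + u ϑ • dir (ϑ + π / 2)) +
                fderiv ℝ (fderiv ℝ (fderiv ℝ e)) (u ϑ • dir ϑ) (deriv u ϑ • dir ϑ + u ϑ • dir (ϑ + π / 2))
                  ((deriv (deriv u) ϑ - u ϑ) • dir ϑ + (2 * deriv u ϑ) • dir (ϑ + π / 2))) +
              (fderiv ℝ (fderiv ℝ (fderiv ℝ e)) (u ϑ • dir ϑ) (deriv u ϑ • dir ϑ + u ϑ • dir (ϑ + π / 2))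
                  ((deriv (deriv u) ϑ - u ϑ) • dir ϑ + (2 * deriv u ϑ) • dir (ϑ + π / 2)) +
                fderiv ℝ (fderiv ℝ e) (u ϑ • dir ϑ)
                  ((deriv (deriv (deriv u)) ϑ - 3 * deriv u ϑ) • dir ϑ + (3 * deriv (deriv u) ϑ - u ϑ) • dir (ϑ + π / 2))))
              (dir ϑ) +
            (fderiv ℝ (fderiv ℝ (fderiv ℝ e)) (u ϑ • dir ϑ) (deriv u ϑ • dir ϑ + u ϑ • dir (ϑ + π / 2))
                (deriv u ϑ • dir ϑ + u ϑ • dir (ϑ + π / 2)) +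
              fderiv ℝ (fderiv ℝ e) (u ϑ • dir ϑ) ((deriv (deriv u) ϑ - u ϑ) • dir ϑ + (2 * deriv u ϑ) • dir (ϑ + π / 2)))
              (dir (ϑ + π / 2))) +
          ((fderiv ℝ (fderiv ℝ (fderiv ℝ e)) (u ϑ • dir ϑ) (deriv u ϑ • dir ϑ + u ϑ • dir (ϑ + π / 2))
                (deriv u ϑ • dir ϑ + u ϑ • dir (ϑ + π / 2)) +
              fderiv ℝ (fderiv ℝ e) (u ϑ • dir ϑ) ((deriv (deriv u) ϑ - u ϑ) • dir ϑ + (2 * deriv u ϑ) • dir (ϑ + π / 2)))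
              (dir (ϑ + π / 2)) +
            fderiv ℝ (fderiv ℝ e) (u ϑ • dir ϑ) (deriv u ϑ • dir ϑ + u ϑ • dir (ϑ + π / 2)) (-dir ϑ)) +
        (((fderiv ℝ (fderiv ℝ (fderiv ℝ e)) (u ϑ • dir ϑ) (deriv u ϑ • dir ϑ + u ϑ • dir (ϑ + π / 2))
                  (deriv u ϑ • dir ϑ + u ϑ • dir (ϑ + π / 2)) +
                fderiv ℝ (fderiv ℝ e) (u ϑ • dir ϑ) ((deriv (deriv u) ϑ - u ϑ) • dir ϑ + (2 * deriv u ϑ) • dir (ϑ + π / 2)))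
                (dir (ϑ + π / 2)) +
              fderiv ℝ (fderiv ℝ e) (u ϑ • dir ϑ) (deriv u ϑ • dir ϑ + u ϑ • dir (ϑ + π / 2)) (-dir ϑ)) +
          (fderiv ℝ (fderiv ℝ e) (u ϑ • dir ϑ) (deriv u ϑ • dir ϑ + u ϑ • dir (ϑ + π / 2)) (-dir ϑ) +
            fderiv ℝ e (u ϑ • dir ϑ) (-dir (ϑ + π / 2))))| ≤
      E₄ * (R₁ + U₀) ^ 3 + 3 * (E₃ * (R₁ + U₀) * (R₂ + 2 * R₁ + U₀)) + 3 * (E₃ * (R₁ + U₀) ^ 2) +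
        E₂ * (R₃ + 3 * R₂ + 3 * R₁ + U₀) + 3 * (E₂ * (R₂ + 2 * R₁ + U₀)) + 3 * (E₂ * (R₁ + U₀)) + E₁ := by
  set c₁ := fderiv ℝ e (u ϑ • dir ϑ) with hc₁
  set c₂ := fderiv ℝ (fderiv ℝ e) (u ϑ • dir ϑ) with hc₂
  set c₃ := fderiv ℝ (fderiv ℝ (fderiv ℝ e)) (u ϑ • dir ϑ) with hc₃
  set c₄ := fderiv ℝ (fderiv ℝ (fderiv ℝ (fderiv ℝ e))) (u ϑ • dir ϑ) with hc₄
  set v₁ := deriv u ϑ • dir ϑ + u ϑ • dir (ϑ + π / 2) with hv₁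
  set v₂ := (deriv (deriv u) ϑ - u ϑ) • dir ϑ + (2 * deriv u ϑ) • dir (ϑ + π / 2) with hv₂
  set v₃ := (deriv (deriv (deriv u)) ϑ - 3 * deriv u ϑ) • dir ϑ + (3 * deriv (deriv u) ϑ - u ϑ) • dir (ϑ + π / 2) with hv₃
  set d := dir ϑ with hd
  set dp := dir (ϑ + π / 2) with hdp
  -- sizes of the curve derivatives and of the frame vectors
  have hK1 : ‖v₁‖ ≤ R₁ + U₀ := (norm_frame_comb_le _ _ ϑ).trans (add_le_add hR₁ hU₀)
  have hK2 : ‖v₂‖ ≤ R₂ + 2 * R₁ + U₀ := by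
    refine (norm_frame_comb_le _ _ ϑ).trans ?_
    have h1 : |deriv (deriv u) ϑ - u ϑ| ≤ R₂ + U₀ := (abs_sub _ _).trans (add_le_add hR₂ hU₀)
    have h2 : |2 * deriv u ϑ| ≤ 2 * R₁ := by rw [abs_mul, abs_two]; linarith
    linarith
  have hK3 : ‖v₃‖ ≤ R₃ + 3 * R₂ + 3 * R₁ + U₀ := by
    refine (norm_frame_comb_le _ _ ϑ).trans ?_
    have h1 : |deriv (deriv (deriv u)) ϑ - 3 * deriv u ϑ| ≤ R₃ + 3 * R₁ := by
      refine (abs_sub _ _).trans ?_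
      rw [abs_mul, show |(3 : ℝ)| = 3 by norm_num]; linarith
    have h2 : |3 * deriv (deriv u) ϑ - u ϑ| ≤ 3 * R₂ + U₀ := by
      refine (abs_sub _ _).trans ?_
      rw [abs_mul, show |(3 : ℝ)| = 3 by norm_num]; linarith
    linarith
  have hd1 : ‖d‖ ≤ 1 := norm_dir_le_one ϑ; have hdp1 : ‖dp‖ ≤ 1 := norm_dir_le_one _
  have hdn : ‖-d‖ ≤ 1 := by rw [norm_neg]; exact hd1
  have hdpn : ‖-dp‖ ≤ 1 := by rw [norm_neg]; exact hdp1
  have hE₁0 : 0 ≤ E₁ := (norm_nonneg _).trans hE₁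
  -- the eleven elementary terms
  have t1 := abs_clm₄_le c₄ v₁ v₁ v₁ d hE₄ hK1 hK1 hK1 hd1
  have t2 := abs_clm₃_le c₃ v₂ v₁ d hE₃ hK2 hK1 hd1
  have t3 := abs_clm₃_le c₃ v₁ v₂ d hE₃ hK1 hK2 hd1
  have t4 := abs_clm₃_le c₃ v₁ v₂ d hE₃ hK1 hK2 hd1
  have t5 := abs_clm₂_le c₂ v₃ d hE₂ hK3 hd1
  have t6 := abs_clm₃_le c₃ v₁ v₁ dp hE₃ hK1 hK1 hdp1
  have t7 := abs_clm₂_le c₂ v₂ dp hE₂ hK2 hdp1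
  have t8 := abs_clm₂_le c₂ v₁ (-d) hE₂ hK1 hdn
  have t9 := abs_clm₁_le c₁ (-dp) hE₁ hdpn
  -- expand the continuous-linear sums (pointwise by definition)
  have hexp : ((((c₄ v₁ v₁ + c₃ v₂) v₁ + c₃ v₁ v₂) + (c₃ v₁ v₂ + c₂ v₃)) d + (c₃ v₁ v₁ + c₂ v₂) dp) +
        ((c₃ v₁ v₁ + c₂ v₂) dp + c₂ v₁ (-d)) + (((c₃ v₁ v₁ + c₂ v₂) dp + c₂ v₁ (-d)) + (c₂ v₁ (-d) + c₁ (-dp))) =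
      (c₄ v₁ v₁ v₁ d + c₃ v₂ v₁ d + c₃ v₁ v₂ d + (c₃ v₁ v₂ d + c₂ v₃ d) + (c₃ v₁ v₁ dp + c₂ v₂ dp)) +
        (c₃ v₁ v₁ dp + c₂ v₂ dp + c₂ v₁ (-d)) + ((c₃ v₁ v₁ dp + c₂ v₂ dp + c₂ v₁ (-d)) + (c₂ v₁ (-d) + c₁ (-dp))) := rfl
  rw [hexp]
  have B1 : |c₄ v₁ v₁ v₁ d + c₃ v₂ v₁ d + c₃ v₁ v₂ d + (c₃ v₁ v₂ d + c₂ v₃ d) + (c₃ v₁ v₁ dp + c₂ v₂ dp)| ≤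
      E₄ * (R₁ + U₀) * (R₁ + U₀) * (R₁ + U₀) * 1 + E₃ * (R₂ + 2 * R₁ + U₀) * (R₁ + U₀) * 1 +
        E₃ * (R₁ + U₀) * (R₂ + 2 * R₁ + U₀) * 1 + (E₃ * (R₁ + U₀) * (R₂ + 2 * R₁ + U₀) * 1 + E₂ * (R₃ + 3 * R₂ + 3 * R₁ + U₀) * 1) +
        (E₃ * (R₁ + U₀) * (R₁ + U₀) * 1 + E₂ * (R₂ + 2 * R₁ + U₀) * 1) := by
    refine (abs_add_le _ _).trans (add_le_add ((abs_add_le _ _).trans (add_le_add ((abs_add_le _ _).trans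
      (add_le_add ((abs_add_le _ _).trans (add_le_add t1 t2)) t3)) ((abs_add_le _ _).trans (add_le_add t4 t5))))
      ((abs_add_le _ _).trans (add_le_add t6 t7)))
  have B2 : |c₃ v₁ v₁ dp + c₂ v₂ dp + c₂ v₁ (-d)| ≤
      E₃ * (R₁ + U₀) * (R₁ + U₀) * 1 + E₂ * (R₂ + 2 * R₁ + U₀) * 1 + E₂ * (R₁ + U₀) * 1 :=
    (abs_add_le _ _).trans (add_le_add ((abs_add_le _ _).trans (add_le_add t6 t7)) t8)
  have B3 : |(c₃ v₁ v₁ dp + c₂ v₂ dp + c₂ v₁ (-d)) + (c₂ v₁ (-d) + c₁ (-dp))| ≤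
      (E₃ * (R₁ + U₀) * (R₁ + U₀) * 1 + E₂ * (R₂ + 2 * R₁ + U₀) * 1 + E₂ * (R₁ + U₀) * 1) + (E₂ * (R₁ + U₀) * 1 + E₁ * 1) :=
    (abs_add_le _ _).trans (add_le_add B2 ((abs_add_le _ _).trans (add_le_add t8 t9)))
  calc _ ≤ |c₄ v₁ v₁ v₁ d + c₃ v₂ v₁ d + c₃ v₁ v₂ d + (c₃ v₁ v₂ d + c₂ v₃ d) + (c₃ v₁ v₁ dp + c₂ v₂ dp)| +
        |c₃ v₁ v₁ dp + c₂ v₂ dp + c₂ v₁ (-d)| + |(c₃ v₁ v₁ dp + c₂ v₂ dp + c₂ v₁ (-d)) + (c₂ v₁ (-d) + c₁ (-dp))| :=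
          (abs_add_le _ _).trans (add_le_add (abs_add_le _ _) le_rfl)
    _ ≤ _ := add_le_add (add_le_add B1 B2) B3
    _ = _ := by ring


/-! ## §2–§3 The third derivative of `J = u/D` -/

/-- **Order 3**: `|J‴| ≤ R₃/ρ₀ + 3R₂Δ₁/ρ₀² + 3R₁Δ₂/ρ₀² + 6R₁Δ₁²/ρ₀³ + U₀Δ₃/ρ₀² + 6U₀Δ₁Δ₂/ρ₀³ + 6U₀Δ₁³/ρ₀⁴`, with
`Δ₁ = E₂K₁ + E₁`, `Δ₂ = E₃K₁² + E₂K₂ + 2E₂K₁ + E₁`, `Δ₃ = E₄K₁³ + 3E₃K₁K₂ + 3E₃K₁² + E₂K₃ + 3E₂K₂ + 3E₂K₁ + E₁`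
(`K₁ = R₁+U₀`, `K₂ = R₂+2R₁+U₀`, `K₃ = R₃+3R₂+3R₁+U₀`) — graded, affine in `E₄`. -/
theorem abs_deriv_three_polarJac_le {ρ₀ E₁ E₂ E₃ E₄ U₀ R₁ R₂ R₃ : ℝ} (hρ0 : 0 < ρ₀)
    (hρ : ∀ ϑ, ρ₀ ≤ fderiv ℝ e (u ϑ • dir ϑ) (dir ϑ))
    (hE₁ : ∀ ϑ, ‖fderiv ℝ e (u ϑ • dir ϑ)‖ ≤ E₁) (hE₂ : ∀ ϑ, ‖fderiv ℝ (fderiv ℝ e) (u ϑ • dir ϑ)‖ ≤ E₂)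
    (hE₃ : ∀ ϑ, ‖fderiv ℝ (fderiv ℝ (fderiv ℝ e)) (u ϑ • dir ϑ)‖ ≤ E₃)
    (hE₄ : ∀ ϑ, ‖fderiv ℝ (fderiv ℝ (fderiv ℝ (fderiv ℝ e))) (u ϑ • dir ϑ)‖ ≤ E₄)
    (hU₀ : ∀ ϑ, |u ϑ| ≤ U₀) (hR₁ : ∀ ϑ, |deriv u ϑ| ≤ R₁) (hR₂ : ∀ ϑ, |deriv (deriv u) ϑ| ≤ R₂)
    (hR₃ : ∀ ϑ, |deriv (deriv (deriv u)) ϑ| ≤ R₃) (ϑ : ℝ) :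
    |deriv (deriv (deriv (fun t : ℝ => u t / fderiv ℝ e (u t • dir t) (dir t)))) ϑ| ≤
      R₃ / ρ₀ + 3 * (R₂ * (E₂ * (R₁ + U₀) + E₁)) / ρ₀ ^ 2 +
        3 * (R₁ * (E₃ * (R₁ + U₀) ^ 2 + E₂ * (R₂ + 2 * R₁ + U₀) + 2 * (E₂ * (R₁ + U₀)) + E₁)) / ρ₀ ^ 2 +
        6 * (R₁ * (E₂ * (R₁ + U₀) + E₁) ^ 2) / ρ₀ ^ 3 +
        U₀ * (E₄ * (R₁ + U₀) ^ 3 + 3 * (E₃ * (R₁ + U₀) * (R₂ + 2 * R₁ + U₀)) + 3 * (E₃ * (R₁ + U₀) ^ 2) +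
          E₂ * (R₃ + 3 * R₂ + 3 * R₁ + U₀) + 3 * (E₂ * (R₂ + 2 * R₁ + U₀)) + 3 * (E₂ * (R₁ + U₀)) + E₁) / ρ₀ ^ 2 +
        6 * (U₀ * ((E₂ * (R₁ + U₀) + E₁) * (E₃ * (R₁ + U₀) ^ 2 + E₂ * (R₂ + 2 * R₁ + U₀) + 2 * (E₂ * (R₁ + U₀)) + E₁))) / ρ₀ ^ 3 +
        6 * (U₀ * (E₂ * (R₁ + U₀) + E₁) ^ 3) / ρ₀ ^ 4 := by
  -- the three radial-slope functions and their derivatives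
  set Df : ℝ → ℝ := fun t => fderiv ℝ e (u t • dir t) (dir t) with hDf
  set D1f : ℝ → ℝ := fun t => fderiv ℝ (fderiv ℝ e) (u t • dir t) (deriv u t • dir t + u t • dir (t + π / 2)) (dir t) +
    fderiv ℝ e (u t • dir t) (dir (t + π / 2)) with hD1f
  set D2f : ℝ → ℝ := fun t =>
    (fderiv ℝ (fderiv ℝ (fderiv ℝ e)) (u t • dir t) (deriv u t • dir t + u t • dir (t + π / 2))
          (deriv u t • dir t + u t • dir (t + π / 2)) +
        fderiv ℝ (fderiv ℝ e) (u t • dir t) ((deriv (deriv u) t - u t) • dir t + (2 * deriv u t) • dir (t + π / 2))) (dir t) +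
      fderiv ℝ (fderiv ℝ e) (u t • dir t) (deriv u t • dir t + u t • dir (t + π / 2)) (dir (t + π / 2)) +
      (fderiv ℝ (fderiv ℝ e) (u t • dir t) (deriv u t • dir t + u t • dir (t + π / 2)) (dir (t + π / 2)) +
        fderiv ℝ e (u t • dir t) (-dir t)) with hD2f
  have hDne : ∀ t, Df t ≠ 0 := fun t => (hρ0.trans_le (hρ t)).ne'
  have hD0 : ∀ t, HasDerivAt Df (D1f t) t := fun t => hasDerivAt_radialSlope he hu t
  have hD1 : ∀ t, HasDerivAt D1f (D2f t) t := fun t => hasDerivAt_radialSlope_deriv he hu t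
  have hD2 := hasDerivAt_radialSlope_deriv_two he hu ϑ
  set D3 : ℝ := deriv D2f ϑ with hD3def
  have hD2' : HasDerivAt D2f D3 ϑ := by rw [hD3def, hD2.deriv]; exact hD2
  -- the u-tower
  have hut : ∀ t, HasDerivAt u (deriv u t) t ∧ HasDerivAt (deriv u) (deriv (deriv u) t) t ∧
      HasDerivAt (deriv (deriv u)) (deriv (deriv (deriv u)) t) t := fun t =>
    let h := hasDerivAt_tower_of_contDiff_four hu t
    ⟨h.1, h.2.1, h.2.2.1⟩
  -- first derivative as a function
  have j1 : deriv (fun t : ℝ => u t / Df t) = fun t => (deriv u t * Df t - u t * D1f t) / Df t ^ 2 :=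
    funext fun t => ((hut t).1.fun_div (hD0 t) (hDne t)).deriv
  -- second derivative as a function, in split form
  have j2 : deriv (fun t => (deriv u t * Df t - u t * D1f t) / Df t ^ 2) = fun t =>
      deriv (deriv u) t / Df t - u t * D2f t / Df t ^ 2 - 2 * (deriv u t * D1f t) / Df t ^ 2 +
        2 * (u t * D1f t ^ 2) / Df t ^ 3 := by
    funext t
    obtain ⟨h0, h1, -⟩ := hut t
    have hnum := (h1.fun_mul (hD0 t)).fun_sub (h0.fun_mul (hD1 t))
    have hden : HasDerivAt (fun s : ℝ => Df s ^ 2) (2 * Df t * D1f t) t := by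
      have h := (hD0 t).fun_mul (hD0 t)
      have hfun : (fun s : ℝ => Df s ^ 2) = fun s => Df s * Df s := funext fun s => sq _
      rw [hfun]; exact h.congr_deriv (by ring)
    have hq : HasDerivAt (fun s : ℝ => (deriv u s * Df s - u s * D1f s) / Df s ^ 2)
        ((((deriv (deriv u) t * Df t + deriv u t * D1f t) - (deriv u t * D1f t + u t * D2f t)) * Df t ^ 2 -
          (deriv u t * Df t - u t * D1f t) * (2 * Df t * D1f t)) / (Df t ^ 2) ^ 2) t :=
      hnum.fun_div hden (pow_ne_zero 2 (hDne t))
    rw [hq.deriv]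
    have hD := hDne t
    field_simp
    ring
  -- third derivative at ϑ
  obtain ⟨h0, h1, h2⟩ := hut ϑ
  have hDϑ := hD0 ϑ
  have hD1ϑ := hD1 ϑ
  have hpow2 : HasDerivAt (fun s : ℝ => Df s ^ 2) (2 * Df ϑ * D1f ϑ) ϑ := by
    have h := hDϑ.fun_mul hDϑ
    have hfun : (fun s : ℝ => Df s ^ 2) = fun s => Df s * Df s := funext fun s => sq _
    rw [hfun]; exact h.congr_deriv (by ring)
  have hpow3 : HasDerivAt (fun s : ℝ => Df s ^ 3) (3 * Df ϑ ^ 2 * D1f ϑ) ϑ := by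
    have h := (hDϑ.fun_mul hDϑ).fun_mul hDϑ
    have hfun : (fun s : ℝ => Df s ^ 3) = fun s => Df s * Df s * Df s := funext fun s => by ring
    rw [hfun]; exact h.congr_deriv (by ring)
  have hsq1 : HasDerivAt (fun s : ℝ => D1f s ^ 2) (2 * D1f ϑ * D2f ϑ) ϑ := by
    have h := hD1ϑ.fun_mul hD1ϑ
    have hfun : (fun s : ℝ => D1f s ^ 2) = fun s => D1f s * D1f s := funext fun s => sq _
    rw [hfun]; exact h.congr_deriv (by ring)
  have hA := h2.fun_div hDϑ (hDne ϑ)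
  have hB := (h0.fun_mul hD2').fun_div hpow2 (pow_ne_zero 2 (hDne ϑ))
  have hC := ((h1.fun_mul hD1ϑ).const_mul 2).fun_div hpow2 (pow_ne_zero 2 (hDne ϑ))
  have hDD := ((h0.fun_mul hsq1).const_mul 2).fun_div hpow3 (pow_ne_zero 3 (hDne ϑ))
  have hJ3 : HasDerivAt (fun t : ℝ =>
      deriv (deriv u) t / Df t - u t * D2f t / Df t ^ 2 - 2 * (deriv u t * D1f t) / Df t ^ 2 +
        2 * (u t * D1f t ^ 2) / Df t ^ 3) _ ϑ := ((hA.fun_sub hB).fun_sub hC).fun_add hDD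
  -- assemble `deriv (deriv (deriv J)) ϑ`
  have hiter : deriv (deriv (deriv (fun t : ℝ => u t / Df t))) ϑ = deriv (fun t =>
      deriv (deriv u) t / Df t - u t * D2f t / Df t ^ 2 - 2 * (deriv u t * D1f t) / Df t ^ 2 +
        2 * (u t * D1f t ^ 2) / Df t ^ 3) ϑ := by
    rw [j1, j2]
  -- simplify to the seven-term form
  set D := Df ϑ with hDdef
  set D₁ := D1f ϑ
  set D₂ := D2f ϑ
  set u0 := u ϑ; set u1 := deriv u ϑ; set u2 := deriv (deriv u) ϑ; set u3 := deriv (deriv (deriv u)) ϑ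
  have hDge : ρ₀ ≤ D := hρ ϑ
  have hDpos : 0 < D := hρ0.trans_le hDge
  have hDabs : ρ₀ ≤ |D| := hDge.trans (le_abs_self _)
  have hval : deriv (fun t =>
      deriv (deriv u) t / Df t - u t * D2f t / Df t ^ 2 - 2 * (deriv u t * D1f t) / Df t ^ 2 +
        2 * (u t * D1f t ^ 2) / Df t ^ 3) ϑ =
      u3 / D - 3 * (u2 * D₁) / D ^ 2 - 3 * (u1 * D₂) / D ^ 2 + 6 * (u1 * D₁ ^ 2) / D ^ 3 - u0 * D3 / D ^ 2 +
        6 * (u0 * (D₁ * D₂)) / D ^ 3 - 6 * (u0 * D₁ ^ 3) / D ^ 4 := by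
    rw [hJ3.deriv]
    have hD := hDpos.ne'
    field_simp
    ring
  rw [hiter, hval]
  -- the sizes
  have hΔ₁ : |D₁| ≤ E₂ * (R₁ + U₀) + E₁ := abs_radialSlope_deriv_le (hE₁ ϑ) (hE₂ ϑ) (hU₀ ϑ) (hR₁ ϑ)
  have hΔ₂ : |D₂| ≤ E₃ * (R₁ + U₀) ^ 2 + E₂ * (R₂ + 2 * R₁ + U₀) + 2 * (E₂ * (R₁ + U₀)) + E₁ :=
    abs_radialSlope_deriv_two_le (hE₁ ϑ) (hE₂ ϑ) (hE₃ ϑ) (hU₀ ϑ) (hR₁ ϑ) (hR₂ ϑ)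
  have hΔ₃ : |D3| ≤ E₄ * (R₁ + U₀) ^ 3 + 3 * (E₃ * (R₁ + U₀) * (R₂ + 2 * R₁ + U₀)) + 3 * (E₃ * (R₁ + U₀) ^ 2) +
      E₂ * (R₃ + 3 * R₂ + 3 * R₁ + U₀) + 3 * (E₂ * (R₂ + 2 * R₁ + U₀)) + 3 * (E₂ * (R₁ + U₀)) + E₁ := by
    rw [hD3def, hD2.deriv]
    exact abs_radialSlope_deriv_three_le (hE₁ ϑ) (hE₂ ϑ) (hE₃ ϑ) (hE₄ ϑ) (hU₀ ϑ) (hR₁ ϑ) (hR₂ ϑ) (hR₃ ϑ)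
  set Δ1 := E₂ * (R₁ + U₀) + E₁ with hΔ1def
  set Δ2 := E₃ * (R₁ + U₀) ^ 2 + E₂ * (R₂ + 2 * R₁ + U₀) + 2 * (E₂ * (R₁ + U₀)) + E₁ with hΔ2def
  set Δ3 := E₄ * (R₁ + U₀) ^ 3 + 3 * (E₃ * (R₁ + U₀) * (R₂ + 2 * R₁ + U₀)) + 3 * (E₃ * (R₁ + U₀) ^ 2) +
      E₂ * (R₃ + 3 * R₂ + 3 * R₁ + U₀) + 3 * (E₂ * (R₂ + 2 * R₁ + U₀)) + 3 * (E₂ * (R₁ + U₀)) + E₁ with hΔ3def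
  have hU0 : 0 ≤ U₀ := (abs_nonneg _).trans (hU₀ ϑ); have hR10 : 0 ≤ R₁ := (abs_nonneg _).trans (hR₁ ϑ)
  have hR20 : 0 ≤ R₂ := (abs_nonneg _).trans (hR₂ ϑ); have hΔ10 : 0 ≤ Δ1 := (abs_nonneg _).trans hΔ₁
  have hΔ20 : 0 ≤ Δ2 := (abs_nonneg _).trans hΔ₂; have hΔ30 : 0 ≤ Δ3 := (abs_nonneg _).trans hΔ₃
  have hp2 : ρ₀ ^ 2 ≤ |D| ^ 2 := pow_le_pow_left₀ hρ0.le hDabs 2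
  have hp3 : ρ₀ ^ 3 ≤ |D| ^ 3 := pow_le_pow_left₀ hρ0.le hDabs 3
  have hp4 : ρ₀ ^ 4 ≤ |D| ^ 4 := pow_le_pow_left₀ hρ0.le hDabs 4
  -- seven terms
  have t1 : |u3 / D| ≤ R₃ / ρ₀ := by
    rw [abs_div]; exact div_le_div₀ ((abs_nonneg _).trans (hR₃ ϑ)) (hR₃ ϑ) hρ0 hDabs
  have t2 : |3 * (u2 * D₁) / D ^ 2| ≤ 3 * (R₂ * Δ1) / ρ₀ ^ 2 := by
    rw [abs_div, abs_mul, abs_mul, abs_pow, show |(3 : ℝ)| = 3 by norm_num]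
    exact div_le_div₀ (by positivity) (mul_le_mul_of_nonneg_left (mul_le_mul (hR₂ ϑ) hΔ₁ (abs_nonneg _) hR20) (by norm_num))
      (pow_pos hρ0 2) hp2
  have t3 : |3 * (u1 * D₂) / D ^ 2| ≤ 3 * (R₁ * Δ2) / ρ₀ ^ 2 := by
    rw [abs_div, abs_mul, abs_mul, abs_pow, show |(3 : ℝ)| = 3 by norm_num]
    exact div_le_div₀ (by positivity) (mul_le_mul_of_nonneg_left (mul_le_mul (hR₁ ϑ) hΔ₂ (abs_nonneg _) hR10) (by norm_num))
      (pow_pos hρ0 2) hp2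
  have t4 : |6 * (u1 * D₁ ^ 2) / D ^ 3| ≤ 6 * (R₁ * Δ1 ^ 2) / ρ₀ ^ 3 := by
    rw [abs_div, abs_mul, abs_mul, abs_pow, abs_pow, show |(6 : ℝ)| = 6 by norm_num]
    have hsq : |D₁| ^ 2 ≤ Δ1 ^ 2 := pow_le_pow_left₀ (abs_nonneg _) hΔ₁ 2
    exact div_le_div₀ (by positivity) (mul_le_mul_of_nonneg_left (mul_le_mul (hR₁ ϑ) hsq (by positivity) hR10) (by norm_num))
      (pow_pos hρ0 3) hp3
  have t5 : |u0 * D3 / D ^ 2| ≤ U₀ * Δ3 / ρ₀ ^ 2 := by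
    rw [abs_div, abs_mul, abs_pow]
    exact div_le_div₀ (mul_nonneg hU0 hΔ30) (mul_le_mul (hU₀ ϑ) hΔ₃ (abs_nonneg _) hU0) (pow_pos hρ0 2) hp2
  have t6 : |6 * (u0 * (D₁ * D₂)) / D ^ 3| ≤ 6 * (U₀ * (Δ1 * Δ2)) / ρ₀ ^ 3 := by
    rw [abs_div, abs_mul, abs_mul, abs_mul, abs_pow, show |(6 : ℝ)| = 6 by norm_num]
    exact div_le_div₀ (by positivity)
      (mul_le_mul_of_nonneg_left (mul_le_mul (hU₀ ϑ) (mul_le_mul hΔ₁ hΔ₂ (abs_nonneg _) hΔ10)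
        (mul_nonneg (abs_nonneg _) (abs_nonneg _)) hU0) (by norm_num)) (pow_pos hρ0 3) hp3
  have t7 : |6 * (u0 * D₁ ^ 3) / D ^ 4| ≤ 6 * (U₀ * Δ1 ^ 3) / ρ₀ ^ 4 := by
    rw [abs_div, abs_mul, abs_mul, abs_pow, abs_pow, show |(6 : ℝ)| = 6 by norm_num]
    have hcb : |D₁| ^ 3 ≤ Δ1 ^ 3 := pow_le_pow_left₀ (abs_nonneg _) hΔ₁ 3
    exact div_le_div₀ (by positivity) (mul_le_mul_of_nonneg_left (mul_le_mul (hU₀ ϑ) hcb (by positivity) hU0) (by norm_num))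
      (pow_pos hρ0 4) hp4
  calc |u3 / D - 3 * (u2 * D₁) / D ^ 2 - 3 * (u1 * D₂) / D ^ 2 + 6 * (u1 * D₁ ^ 2) / D ^ 3 - u0 * D3 / D ^ 2 +
          6 * (u0 * (D₁ * D₂)) / D ^ 3 - 6 * (u0 * D₁ ^ 3) / D ^ 4|
      ≤ |u3 / D| + |3 * (u2 * D₁) / D ^ 2| + |3 * (u1 * D₂) / D ^ 2| + |6 * (u1 * D₁ ^ 2) / D ^ 3| + |u0 * D3 / D ^ 2| +
          |6 * (u0 * (D₁ * D₂)) / D ^ 3| + |6 * (u0 * D₁ ^ 3) / D ^ 4| := by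
        refine (abs_sub _ _).trans (add_le_add ?_ le_rfl)
        refine (abs_add_le _ _).trans (add_le_add ?_ le_rfl)
        refine (abs_sub _ _).trans (add_le_add ?_ le_rfl)
        refine (abs_add_le _ _).trans (add_le_add ?_ le_rfl)
        refine (abs_sub _ _).trans (add_le_add ?_ le_rfl)
        exact abs_sub _ _
    _ ≤ R₃ / ρ₀ + 3 * (R₂ * Δ1) / ρ₀ ^ 2 + 3 * (R₁ * Δ2) / ρ₀ ^ 2 + 6 * (R₁ * Δ1 ^ 2) / ρ₀ ^ 3 + U₀ * Δ3 / ρ₀ ^ 2 +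
          6 * (U₀ * (Δ1 * Δ2)) / ρ₀ ^ 3 + 6 * (U₀ * Δ1 ^ 3) / ρ₀ ^ 4 :=
        add_le_add (add_le_add (add_le_add (add_le_add (add_le_add (add_le_add t1 t2) t3) t4) t5) t6) t7
    _ = _ := by ring

end Polar

end Summit.HubbardSuperconductivity.HubbardSuperconductivity.Theorems.C4a
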